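import Mathlib
import Summits.ValiantsHypothesis.ValiantsHypothesis.Theorems.ValuativeGCTValuativeFlipHessenbergPencilDefs
import Summits.ValiantsHypothesis.ValiantsHypothesis.Theorems.ValuativeGCTValuativeFlipPencilWeightSplit
import Summits.ValiantsHypothesis.ValiantsHypothesis.Theorems.ValuativeGCTValuativeFlipDegenerationStep
import Summits.ValiantsHypothesis.ValiantsHypothesis.Theorems.ValuativeGCTValuativeFlipHessenbergCofactors
import Summits.ValiantsHypothesis.ValiantsHypothesis.Theorems.ValuativeGCTValuativeFlipBorderRecurrences

/-!
# The pencil `HB_n`: charge grading, class split, and the instantiated border identities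
# (crux `ValuativeGCT.ValuativeFlip`, stmt-ValiantsHypothesis-12624; wall-breaker k1 gen 1)

Helper file (`--supports stmt-ValiantsHypothesis-12624`) for the heart stub `stub_fourRowPencilRank` via the open
Hessenberg four-band pencil (`…HessenbergPencilDefs.lean`, `Cruxes/ValuativeFlip/AxisK1G1HessenbergPencil.md`).  It connects
the definitions with the general machinery already landed:

* CHARGE GRADING (`hb_pencil_grading`): every nonzero cell `(r, s)` of `hbPencil` carrying `y_t` has `w t = s − r` for
  `w = (−1, 0, 1, 2)`; hence every generator `y_t · Per_ij(HB_n)` is weighted-homogeneous of charge `w t + (i − j)`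
  (`hb_generator_isWeightedHomogeneous`, k10g1's `pws_isWeightedHomogeneous_gen`) and the span splits:
  `Σ_{Q ∈ T} rank_Q ≤ s(HB_n)` for every finite set of classes (`hb_sum_classRank_le`) — item 2 of the AXIS programme;
* RESTRICTION: the top-left restriction of the point `hbForm … (n+1)` IS `hbForm … n` as a function (`hbForm_restrict`);
* the WALK RECURRENCE of the last-row generators with the explicit border entries
  `Per_{N,j} = b_{N-1} y₂ Per⁽ᴺ⁻¹⁾_{N-1,j} + d_{N-2} y₃ Per⁽ᴺ⁻¹⁾_{N-2,j}` (`hb_lastRow_recurrence`);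
* UPPER GENERATORS ARE PRODUCTS for `HB_n` (`hb_upper_generator`, from `hb_aeval_pderiv_perPoly_upper`);
* at the degenerate parameter `c_{N} = 0` (weights `Function.update c (n+1) 0`): interior generators are
  `a_{N} y₁ ·` the generators of `HB_{N-1}` and the last-column generators vanish (`hb_interior_generator_at_zero`,
  `hb_lastCol_generator_at_zero`) — the `c = 0` data of the degeneration step.
No new definitions; everything is unfolding plus the landed lemmas.
-/

set_option linter.dupNamespace false

namespace Summit.ValiantsHypothesis.ValiantsHypothesis.Theorems.ValuativeFlip

open MvPolynomial Literature.Computability.AlgebraicComplexity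
open scoped BigOperators

noncomputable section

variable (a b c d : ℕ → ℂ)

/-- The charge vector `w = (−1, 0, 1, 2)` of the four variables `y₀, y₁, y₂, y₃` as a function `Fin 4 → ℤ`. [this crux] -/
theorem hb_pencil_grading (n : ℕ) (r s : Fin n) (t : Fin 4) (h : hbPencil a b c d n (r, s) t ≠ 0) :
    (![-1, 0, 1, 2] : Fin 4 → ℤ) t = ((s : ℕ) : ℤ) - ((r : ℕ) : ℤ) := by
  simp only [hbPencil] at h
  split_ifs at h with h0 h1 h2 h3
  · obtain ⟨hv, rfl⟩ := h0; simp; omega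
  · obtain ⟨hv, rfl⟩ := h1; simp; omega
  · obtain ⟨hv, rfl⟩ := h2; simp; omega
  · obtain ⟨hv, rfl⟩ := h3; simp; omega
  · exact absurd rfl h

/-- Every generator `y_t · Per_ij(HB_n)` is weighted-homogeneous of charge `w t + (i − j)` for the grading
`w = (−1,0,1,2)` (an instance of `pws_isWeightedHomogeneous_gen` with potential `h r = r`). [this crux] -/
theorem hb_generator_isWeightedHomogeneous (n : ℕ) (t : Fin 4) (i j : Fin n) :
    IsWeightedHomogeneous (![-1, 0, 1, 2] : Fin 4 → ℤ)
      ((X t : MvPolynomial (Fin 4) ℂ) * aeval (hbForm a b c d n) (pderiv (i, j) (perPoly (Fin n) ℂ)))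
      ((![-1, 0, 1, 2] : Fin 4 → ℤ) t + ((((i : ℕ) : ℤ)) - ((j : ℕ) : ℤ))) := by
  have hM : ∀ r s t, hbPencil a b c d n (r, s) t ≠ 0 →
      (![-1, 0, 1, 2] : Fin 4 → ℤ) t = (fun x : Fin n => ((x : ℕ) : ℤ)) s - (fun x : Fin n => ((x : ℕ) : ℤ)) r :=
    fun r s t h => hb_pencil_grading a b c d n r s t h
  exact pws_isWeightedHomogeneous_gen (![-1, 0, 1, 2] : Fin 4 → ℤ) (fun x : Fin n => ((x : ℕ) : ℤ))
    (hbPencil a b c d n) hM t i j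

omit a b c d in
/-- **Class split for `HB_n`.**  For every finite set `T` of charges, the sum over `Q ∈ T` of the ranks of the
class-`Q` generators is at most the rank of all generators: `Σ_{Q ∈ T} rank_Q ≤ s(HB_n)` (k10g1's
`pws_sum_finrank_le_finrank_span`). [this crux] -/
theorem hb_sum_classRank_le (a b c d : ℕ → ℂ) (n : ℕ) (T : Finset ℤ) :
    ∑ Q ∈ T, Module.finrank ℂ ↥(Submodule.span ℂ
        ((fun tc : Fin 4 × (Fin n × Fin n) => (X tc.1 : MvPolynomial (Fin 4) ℂ) *
            aeval (hbForm a b c d n) (pderiv tc.2 (perPoly (Fin n) ℂ))) ''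
          {tc | (![-1, 0, 1, 2] : Fin 4 → ℤ) tc.1 + ((((tc.2.1 : ℕ) : ℤ)) - ((tc.2.2 : ℕ) : ℤ)) = Q})) ≤
      Module.finrank ℂ ↥(Submodule.span ℂ (Set.range fun tc : Fin 4 × (Fin n × Fin n) =>
        (X tc.1 : MvPolynomial (Fin 4) ℂ) * aeval (hbForm a b c d n) (pderiv tc.2 (perPoly (Fin n) ℂ)))) := by
  classical
  exact pws_sum_finrank_le_finrank_span (![-1, 0, 1, 2] : Fin 4 → ℤ) _
    (fun tc : Fin 4 × (Fin n × Fin n) => (![-1, 0, 1, 2] : Fin 4 → ℤ) tc.1 + ((((tc.2.1 : ℕ) : ℤ)) - ((tc.2.2 : ℕ) : ℤ)))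
    (fun tc => hb_generator_isWeightedHomogeneous a b c d n tc.1 tc.2.1 tc.2.2) T

/-- RESTRICTION as functions: the top-left restriction of the size-`n+1` point is the size-`n` point. [this crux] -/
theorem hbForm_restrict (n : ℕ) :
    (fun q : Fin n × Fin n => hbForm a b c d (n + 1) (Fin.castSucc q.1, Fin.castSucc q.2)) = hbForm a b c d n := by
  funext q
  exact hbForm_castSucc a b c d n q

/-- **Walk recurrence for `HB`** (last-row generators, explicit border):
`Per_{N,l}(HB_{n+3}) = (b (n+1) • y₂) · Per_{N-1,l}(HB_{n+2}) + (d n • y₃) · Per_{N-2,l}(HB_{n+2})`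
(`hb_lastRow_generator_two_term` with the two border entries of `hbForm`). [this crux] -/
theorem hb_lastRow_recurrence (n : ℕ) (l : Fin (n + 2)) :
    aeval (hbForm a b c d (n + 3)) (pderiv (Fin.last (n + 2), Fin.castSucc l) (perPoly (Fin (n + 3)) ℂ)) =
      (b (n + 1) • (X 2 : MvPolynomial (Fin 4) ℂ)) *
          aeval (hbForm a b c d (n + 2)) (pderiv (Fin.last (n + 1), l) (perPoly (Fin (n + 2)) ℂ)) +
        (d n • (X 3 : MvPolynomial (Fin 4) ℂ)) *
          aeval (hbForm a b c d (n + 2)) (pderiv (Fin.castSucc (Fin.last n), l) (perPoly (Fin (n + 2)) ℂ)) := by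
  rw [hb_lastRow_generator_two_term (K := ℂ) (hbForm a b c d (n + 3)) (hbForm_lastCol_eq_zero a b c d n) l,
    hbForm_restrict, hbForm_apply_super a b c d (n + 3) _ (by simp), hbForm_apply_super2 a b c d (n + 3) _ (by simp)]
  simp

/-- **Upper generators of `HB_n` are products** (`hb_aeval_pderiv_perPoly_upper` for `hbForm`, lower bandwidth one):
for `i ≤ j`, `Per_{ij}(HB_{n+1}) = (∏_{i<r≤j} c r • y₀) · per(HB|_{<i}) · per(HB|_{>j})`. [this crux] -/
theorem hb_upper_generator (n : ℕ) (i j : Fin (n + 1)) (hij : i ≤ j) :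
    aeval (hbForm a b c d (n + 1)) (pderiv (i, j) (perPoly (Fin (n + 1)) ℂ)) =
      (∏ x : Fin ((j : ℕ) - i), hbForm a b c d (n + 1) (⟨(i : ℕ) + x + 1, by omega⟩, ⟨(i : ℕ) + x, by omega⟩)) *
      (Matrix.of fun p q : Fin i => hbForm a b c d (n + 1) (Fin.castLE (show (i : ℕ) ≤ n + 1 by omega) p,
        Fin.castLE (show (i : ℕ) ≤ n + 1 by omega) q)).permanent *
      (Matrix.of fun p q : Fin (n - j) => hbForm a b c d (n + 1) ((⟨(j : ℕ) + 1 + p, by omega⟩ : Fin (n + 1)),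
        (⟨(j : ℕ) + 1 + q, by omega⟩ : Fin (n + 1)))).permanent :=
  hb_aeval_pderiv_perPoly_upper (K := ℂ) (hbForm a b c d (n + 1))
    (fun r s h => hbForm_eq_zero_of_lt a b c d (n + 1) r s h) i j hij

/-- The sub-diagonal factors of an upper generator are the monomials `c r • y₀`. [this crux] -/
theorem hb_upper_generator_factor (n : ℕ) (i j : Fin (n + 1)) (x : Fin ((j : ℕ) - i)) :
    hbForm a b c d (n + 1) (⟨(i : ℕ) + x + 1, by omega⟩, ⟨(i : ℕ) + x, by omega⟩) =
      c ((i : ℕ) + x + 1) • (X 0 : MvPolynomial (Fin 4) ℂ) :=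
  hbForm_apply_sub a b c d (n + 1) _ (by simp)

/-- AT THE DEGENERATE PARAMETER `c_{N} = 0` (weights `Function.update c (n+1) 0`, size `N = n+2`): the last row of the point
vanishes off the corner. [this crux] -/
theorem hbForm_lastRow_at_zero (n : ℕ) (j : Fin (n + 1)) :
    hbForm a b (Function.update c (n + 1) 0) d (n + 2) (Fin.last (n + 1), Fin.castSucc j) = 0 := by
  rcases Fin.eq_castSucc_or_eq_last j with ⟨j', rfl⟩ | rfl
  · rw [hbForm_eq]
    simp [show ¬ (n + 1 = (j' : ℕ)) by omega, show ¬ (n + 1 + 1 = (j' : ℕ)) by omega,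
      show ¬ (n + 1 + 2 = (j' : ℕ)) by omega]
  · rw [hbForm_apply_sub a b _ d (n + 2) _ (by simp)]
    simp

/-- Changing the weight `c (n+1)` does not change the size-`n+1` pencil (it only reads `c r` for `r ≤ n`). [this crux] -/
theorem hbForm_update_restrict (n : ℕ) (γ : ℂ) :
    hbForm a b (Function.update c (n + 1) γ) d (n + 1) = hbForm a b c d (n + 1) := by
  funext q
  rw [hbForm_eq, hbForm_eq, Function.update_of_ne (by have := q.1.isLt; omega)]

/-- **Interior generators at `c_N = 0` factor through `HB_{N-1}`**: for old `k, l`,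
`Per_{kl}(HB_{n+2} with c (n+1) = 0) = (a (n+1) • y₁) · Per_{kl}(HB_{n+1})`
(`hb_aeval_pderiv_perPoly_castSucc_castSucc_of_lastRow`). [this crux] -/
theorem hb_interior_generator_at_zero (n : ℕ) (k l : Fin (n + 1)) :
    aeval (hbForm a b (Function.update c (n + 1) 0) d (n + 2))
        (pderiv (Fin.castSucc k, Fin.castSucc l) (perPoly (Fin (n + 2)) ℂ)) =
      (a (n + 1) • (X 1 : MvPolynomial (Fin 4) ℂ)) *
        aeval (hbForm a b c d (n + 1)) (pderiv (k, l) (perPoly (Fin (n + 1)) ℂ)) := by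
  rw [hb_aeval_pderiv_perPoly_castSucc_castSucc_of_lastRow (K := ℂ) _ (hbForm_lastRow_at_zero a b c d n) k l,
    hbForm_restrict, hbForm_update_restrict, hbForm_corner]

/-- **Last-column generators vanish at `c_N = 0`** (`hb_aeval_pderiv_perPoly_castSucc_last_of_lastRow`). [this crux] -/
theorem hb_lastCol_generator_at_zero (n : ℕ) (k : Fin (n + 1)) :
    aeval (hbForm a b (Function.update c (n + 1) 0) d (n + 2))
        (pderiv (Fin.castSucc k, Fin.last (n + 1)) (perPoly (Fin (n + 2)) ℂ)) = 0 :=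
  hb_aeval_pderiv_perPoly_castSucc_last_of_lastRow (K := ℂ) _ (hbForm_lastRow_at_zero a b c d n) k

/-- **Last-row generators do not see `c_N`**: they are the same for every value of the weight `c (n+1)`
(row `n+1` is deleted). [this crux] -/
theorem hb_lastRow_generator_update (n : ℕ) (γ : ℂ) (l : Fin (n + 2)) :
    aeval (hbForm a b (Function.update c (n + 1) γ) d (n + 2)) (pderiv (Fin.last (n + 1), l) (perPoly (Fin (n + 2)) ℂ)) =
      aeval (hbForm a b c d (n + 2)) (pderiv (Fin.last (n + 1), l) (perPoly (Fin (n + 2)) ℂ)) := by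
  rw [pb_aeval_pderiv_perPoly, pb_aeval_pderiv_perPoly]
  congr 1
  ext p q
  simp only [Matrix.submatrix_apply, Matrix.of_apply, Fin.succAbove_last]
  rw [hbForm_eq, hbForm_eq, Function.update_of_ne (by simp; omega)]

end

end Summit.ValiantsHypothesis.ValiantsHypothesis.Theorems.ValuativeFlip
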